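import Summits.RiemannHypothesis.RiemannHypothesis.Theorems.TiltedLandingLaw421R3Lens1ArcSignI
import Summits.RiemannHypothesis.RiemannHypothesis.Theorems.TiltedLandingLaw421R3Lens1PieceFramework

/-!
# TiltedLandingLaw421R3 — lens-1 (gen 9, image Z): SIDE-BLOCK DESCENT — the located petal law, typed, with its proved chain to `TopPinning`

LENS-1 gen-9 module image `rh33346-cover/lens-1/SideBlock-v1.lean` (landing target `…/Theorems/TiltedLandingLaw421R3Lens1SideBlock.lean`; TWO imports:
the landed frame `…R3Lens1ArcSignI` (parts A–I: `BadPiece`, `ascStarts`, `ArcCountIneq`, ★ `RhW08.Lens1ArcSign.pinning_of_arcCount_cofinite`) and the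
landed bookkeeping `…R3Lens1PieceFramework` (Y, #RSV-88: `PieceFramework`, `Blocking`, ★ `exists_run_of_blockDescent`, `covered_iff_count`); namespace
`RhW08.Lens1SideBlock`; 0 `sorry`, no instances / notation / private / set_option; cites by FQN, nothing restated).

WHY (SUMMON 6e28798d O9-2).  Image Y proved the combinatorial half of «CONJECTURE B ⇒ PETAL COVER»: on a chained boundary cycle whose piece `0` is the
pole, BLOCK DESCENT (`finish (last piece of a block) < start (first piece)`) forces every generic level onto a run — and, via `covered_iff_count`, the
count inequality `ASC ≤ POLES − 1 + DESC`, which at level `0` is exactly part Fʼs `ArcCountIneq`.  What was missing is the ANALYTIC law that names the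
true petal and its blocks.  This file types it — (T) `SideBlockDescentQ` — for the ISOLATED class (`StrictlyIsolated`: no other upper zero of `f^{(j)}` in
a disc of radius `> Im a` about `Re a`; crossing mates OUTSIDE the disc allowed = crit-1ʼs «partial-overlap theft» population, the class NOT covered by
`RhW08.Lens1PinningIso.pinning_of_jensenIsolated`), types the law-free REALISATION SOCKET (S) `PetalRealisationQ` (standard nodal-domain bookkeeping:
the petalʼs outer boundary walk IS a chained well-formed value cycle with one pole whose blocks are the analytic side blocks), and PROVES the chain
`SideBlockDescentQ → PetalRealisationQ → IsolatedTopPinningQ` and the exact split `IsolatedTopPinningQ → NonIsolatedTopResidualQ → TopPinning`.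

THE OBJECTS (§1; `G = f^{(j)}`, `φ = G′/G`, `D_δ` = the disc of radius `Im a + δ` about `Re a`).  `posFace f j a δ` = `{z ∈ D_δ : Im z > 0, Im φ z > 0}`;
`petal f j a δ` = the union of the connected components of `posFace` whose closure contains `a` (near a zero `a` of `G` the set `{Im φ > 0}` is a
perturbed half-disc BELOW `a`, so this is one component: THE PETAL `Π`); `IsPetalChord f j a δ t₁ t₂` = a bad piece of part F (a maximal arc of the
upper semicircle with `Im φ > 0`, `circleLoop` parameter `t ∈ [0, ½]`, `t = ¼` the top) lying in the closure of `Π`; `HasBaseContact` = some axis point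
of `D_δ` lies in the closure of `Π`.  EAST chords have `t₂ < ¼`, WEST chords `¼ < t₁` (for small `δ` the top point `Re a + i(Im a + δ)` has
`Im φ = −1/δ + O(1) < 0`, so no chord straddles it).  BLOCKS (`BlockEnds`): walking `∂Π` with `Π` on the left one meets, in the image `ζ = P_a(z)` where
`D_δ ∩ ℍ` becomes the upper half-plane and `a` the point `∞` of its boundary circle, the contacts of `Π` with that circle in their cyclic order — east
chords (foot-most first), the pole `a`, west chords (pole-most first), base contacts —; a block is a maximal group of chords met between two
consecutive visits to {pole, base contacts}: WITH a base contact the blocks are E (first = foot-most east chord, last = pole-most) and W (first =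
pole-most west chord, last = foot-most); WITHOUT one there is ONE block W-then-E (first = pole-most west chord, last = pole-most east chord).  Chord
values: start `A = Re φ` at the smaller parameter, finish `B = Re φ` at the larger.  (T) SIDE-BLOCK DESCENT: `B(last) < A(first)` for every block.

CONTENT.  §1 objects · §2 (T) `SideBlockDescentAt`, ★ `SideBlockDescentQ` (OPEN, UNDECIDED-leaning-true: census below) · §3 (S) ★ `PetalRealisationQ`
(OPEN socket, law-free: for small generic `δ` EITHER a degenerate payer — a point `z` of the closed Jensen half-disc with `G z ≠ 0`, `G′ z = G″ z = 0`,
which pays the law outright — OR a `PieceFramework` with a distinguished one-pole cycle and a `Blocking` whose block ends carry the analytic block-end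
values, whose level-`0` ascent surplus dominates part Fʼs `#ascStarts − #descStarts`, and with `2·POLES ≤ N_δ`) · §4 (K) PROVED:
`blockDescent_of_sideBlock` (transfer), `arcCountIneq_of_model` (Y ⇒ part Fʼs inequality), ★★ `isolatedTopPinning_of_laws :
SideBlockDescentQ → PetalRealisationQ → IsolatedTopPinningQ`, `topPinning_of_isolatedSplit : IsolatedTopPinningQ → NonIsolatedTopResidualQ →
TopPinning`, ★★ `topPinning_of_sideBlock : SideBlockDescentQ → PetalRealisationQ → NonIsolatedTopResidualQ → TopPinning`, and the converse
bookkeeping `isolatedTopPinning_of_topPinning`, `nonIsolatedResidual_of_topPinning` (the split is exact).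

CENSUS (toy `φ₀ = P_a + R`, `a = i`, exterior mates + teeth, legal = `NoTallerToucher`, `q′ = 0`; lens-1 `linktoy/sideblock2.py`, `sideblock3.py`,
`sbhunt.py`; grid nodal tracer `h = 0.006`): gen 8: 0 failures / 2 243 blocks; gen 9 (base-contact-aware blocks = this fileʼs `BlockEnds`): 0 failures /
4 176 blocks over 6 097 legal configurations (seeds 91–97; `k = 1`: 2 608, `k = 2`: 987, `k ≥ 3`: 575 up to `k = 6`, merged W-E blocks 6); ascending
petal chords present in 37 configurations, all inside descending blocks; four adversarial hill-climbs on the margin (seeds 201, 301, 302, 401; 5 448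
evaluations): 0 flags.  TIGHTEST margins `A(first) − B(last)`: `k = 1`: 0.0016 random / 0.050 hunted — the single foot chord under a near-tangent
crossing mate (two-body family `m = (x, y)`, `|x − 1| < y < 1`: margin `≈ c(y)·ε`, `ε = 1 + y − x` the crossing depth, 1 671 grid points, 0 negative;
inf `0⁺` at tangency, where the chord disappears); `k = 2`: 0.528 random / 0.279 hunted — ONE tight family: a near-top mate `m₁ ≈ (1⁻, 1⁻)` above the
right foot (foot deep in its Jensen disc ⇒ foot chord; `m₁` also ends its own lobe chord low) plus a second mate `m₂ ≈ (1.47, 0.46)` with the foot ON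
its Jensen circle (`|x₂ − 1| = y₂`: zero cost to the foot-chord budget `h′(0) = R′(1) > 0`, pull `≈ −1/y₂` on `A(first)`) plus a tooth at `≈ 1.9`;
pushing `m₂` closer (`y₂ ≤ 0.3`) severs the lobe from the petal (`k_E = 0`) instead of lowering the margin; `k ≥ 3`: 7.9; merged: 2.3.  The tightest
blocks per class are in `linktoy/sb2_tight.txt` for C6ʼs exact tracer.  NOT NECESSARY for the petal cover (a staircase `A₁ = 0 > B₁ = −1`,
`A₂ = 5 > B₂ = 4` covers every level but is not block-descending), so a failure of (T) would not kill the petal-cover line.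

HOW (T) CAN FAIL: a pole-most chord that ASCENDS strongly (identity part `1/cos θ` of `Re φ` blows up near the top; a legal mate `m ≈ (ε, 1⁻)` makes such a
chord) inside a block whose foot-most chord starts low; or, in the no-base-contact case, `A(W pole-most) ≤ B(E pole-most)` (PVL failure — seen ONLY with
a base contact present, where the law does not ask it).  KEEP/KILL NUMBER: the minimum block margin over C6ʼs exact re-trace of `sb2_tight.txt` and of a
`q′ = 0`, `k_side ≥ 3` bank sample — kill at the first margin `≤ 0` on a generic radius, keep (UNDECIDED → census-true) at 0 / ≥ 10⁴ blocks.

HONEST LABEL / PRICE: §4 is PROVED bookkeeping (forty lines of logic over Y and part H); (T) and (S) are OPEN.  (S) is paper-standard nodal-domain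
analysis (finiteness of the nodal cells of `Im φ` in `D_δ` for generic `δ`, Cauchy–Riemann monotonicity of `Re φ` along nodal arcs = part Mʼs
`re_monotoneOn_of_nodal_left_nonneg`, planarity of the contact order) but it is NOT in the tree and is where a formaliser pays; (T) is the NEW LOCATED LAW,
benchable by C6, for the isolated class only — the clustered class (`q′ ≥ 1`: more poles on `∂Π`, blocks split at every pole visit) needs the multi-pole
form of Yʼs theorem and is NOT typed here.  `TopPinning`, (T), (S), 33346, 33347 OPEN; nothing here bears on the truth of RH; RH is not proved;
checked ≠ landed ≠ proved.
-/

noncomputable section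

namespace RhW08.Lens1SideBlock

open Complex Set Metric Filter Topology
open scoped Real
open Literature.Topology.PlaneTopology Literature.Analysis.Complex
open Summit.RiemannHypothesis.RiemannHypothesis.Theorems.Splittings.JensenWindow
open RhIdea6.G17.W07C7 RhIdea6.G17.W07C7.Rev6 RhIdea6.G18.W07C8.Law421BirthS RhIdea6.G19.W07C11.Seam
open RhIdea6.G20.W07C12.Frac RhIdea6.G20.W07C12.StColP RhW07.C12.FieldSplit RhIdea6.G21.W07C13.TentMax
open RhW07.C14.TwoSided RhW07.C14.Classes RhW07.C14.Lineage RhW07.C14.Booking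
open RhW07.C13.Heredity RhIdea6.G22.W07C15pre.Injection RhW07.E3.Cell RhW07.E3.Lit
open RhW08.Round1 RhW08.StSwap RhW08.Round2 RhW08.QuadW RhW08.SealSwapQ RhW08.SealSwap RhW08.SuccB RhW08.SuccSplit
open RhW08.SuccTheft RhW08.Column RhW08.Hurwitz RhW08.ClusterQ RhW08.ClusterQM RhW08.NewtonDoor RhW08.NewtonDoorGenusOne RhW08.PurseP
open RhW08.Lens1SignCut RhW08.Lens1Coverage RhW08.IsolatedTilt RhW08.Lens1Pinning RhW08.Lens1PinningIso
open RhW08.Lens1ArcSign RhW08.Lens1ValueCycle RhW08.Lens1PieceFramework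

/-! ## §1 The petal, its chords, its base contacts, its blocks -/

/-- The POSITIVE FACE in the upper half of `D_δ`: `Im (G′/G) > 0`, `G = f^{(j)}`. -/
def posFace (f : ℂ → ℂ) (j : ℕ) (a : ℂ) (δ : ℝ) : Set ℂ :=
  {z : ℂ | dist z (a.re : ℂ) < a.im + δ ∧ 0 < z.im ∧ 0 < (deriv (iteratedDeriv j f) z / iteratedDeriv j f z).im}

/-- THE PETAL `Π`: the part of the positive face whose connected component has the pole `a` in its closure. -/
def petal (f : ℂ → ℂ) (j : ℕ) (a : ℂ) (δ : ℝ) : Set ℂ :=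
  {z : ℂ | z ∈ posFace f j a δ ∧ a ∈ closure (connectedComponentIn (posFace f j a δ) z)}

/-- A PETAL CHORD: a bad piece `(t₁, t₂)` of the upper semicircle (part F) lying in the closure of the petal. -/
def IsPetalChord (f : ℂ → ℂ) (j : ℕ) (a : ℂ) (δ t₁ t₂ : ℝ) : Prop :=
  BadPiece f j a δ t₁ t₂ ∧ ∀ t ∈ Ioo t₁ t₂, circleLoop (a.re : ℂ) (a.im + δ) t ∈ closure (petal f j a δ)

/-- BASE CONTACT: the petal reaches the axis inside `D_δ`. -/
def HasBaseContact (f : ℂ → ℂ) (j : ℕ) (a : ℂ) (δ : ℝ) : Prop :=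
  ∃ x : ℝ, |x - a.re| < a.im + δ ∧ ((x : ℂ)) ∈ closure (petal f j a δ)

/-- BLOCK ENDS: `(t₁, t₂)` is the FIRST and `(u₁, u₂)` the LAST petal chord of one block of the boundary walk of `Π` (module docstring «BLOCKS»):
with a base contact, the foot-most and the pole-most EAST chord, or the pole-most and the foot-most WEST chord; without one, the pole-most west and
the pole-most east chord. -/
def BlockEnds (f : ℂ → ℂ) (j : ℕ) (a : ℂ) (δ t₁ t₂ u₁ u₂ : ℝ) : Prop :=
  IsPetalChord f j a δ t₁ t₂ ∧ IsPetalChord f j a δ u₁ u₂ ∧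
    ((HasBaseContact f j a δ ∧ ((t₂ < 1 / 4 ∧ u₂ < 1 / 4) ∨ (1 / 4 < t₁ ∧ 1 / 4 < u₁)) ∧
        ∀ v₁ v₂ : ℝ, IsPetalChord f j a δ v₁ v₂ → (v₂ < 1 / 4 ↔ t₂ < 1 / 4) → t₁ ≤ v₁ ∧ v₁ ≤ u₁) ∨
      (¬ HasBaseContact f j a δ ∧ 1 / 4 < t₁ ∧ u₂ < 1 / 4 ∧
        ∀ v₁ v₂ : ℝ, IsPetalChord f j a δ v₁ v₂ → (1 / 4 < v₁ → t₁ ≤ v₁) ∧ (v₂ < 1 / 4 → v₁ ≤ u₁)))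

/-- STRICTLY ISOLATED top: no other upper zero of `f^{(j)}` within some radius `> Im a` of `Re a` (`q′ = 0` with margin; crossing mates outside
the disc allowed). -/
def StrictlyIsolated (f : ℂ → ℂ) (j : ℕ) (a : ℂ) : Prop :=
  ∃ ρ : ℝ, a.im < ρ ∧ ∀ c : ℂ, iteratedDeriv j f c = 0 → 0 < c.im → c ≠ a → ρ ≤ dist c (a.re : ℂ)

/-- A DEGENERATE PAYER in the closed Jensen half-disc: `G z ≠ 0`, `G′ z = 0`, `G″ z = 0` (a double critical point off the axis, or a degenerate NL
event on it) — the frames on which level `0` is not generic for the petal walk; they satisfy the law outright (`pays_of_degenerate`). -/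
def DegeneratePayer (f : ℂ → ℂ) (j : ℕ) (a z : ℂ) : Prop :=
  (z.re - a.re) ^ 2 + z.im ^ 2 ≤ a.im ^ 2 ∧ 0 ≤ z.im ∧ iteratedDeriv j f z ≠ 0 ∧ iteratedDeriv (j + 1) f z = 0 ∧ iteratedDeriv (j + 2) f z = 0

/-! ## §2 (T) The located law: SIDE-BLOCK DESCENT -/

/-- (T, per radius) SIDE-BLOCK DESCENT on the circle of radius `Im a + δ`: every block of petal chords descends, `B(last) < A(first)`. -/
def SideBlockDescentAt (f : ℂ → ℂ) (j : ℕ) (a : ℂ) (δ : ℝ) : Prop :=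
  ∀ t₁ t₂ u₁ u₂ : ℝ, BlockEnds f j a δ t₁ t₂ u₁ u₂ → (arcPhi f j a δ u₂).re < (arcPhi f j a δ t₁).re

/-- ★ (T) THE SIDE-BLOCK DESCENT LAW (OPEN; census 0 / 6 419 blocks, 0 flags in 4 adversarial hunts): on a legal frame, a strictly isolated upper
zero with no taller toucher has block-descending petals on all small circles off a finite set of radii. -/
def SideBlockDescentQ : Prop :=
  ∀ (η : ℝ) (f : ℂ → ℂ) (x₀ s hmax R Hs : ℝ) (B : ℕ), EngineHyps5 2 η f x₀ s hmax R Hs B → ∀ (j : ℕ) (a : ℂ),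
    iteratedDeriv j f a = 0 → 0 < a.im → NoTallerToucher f j a → StrictlyIsolated f j a →
    ∃ d0 > 0, ∃ E : Set ℝ, E.Finite ∧ ∀ δ ∈ Ioo 0 d0 \ E, SideBlockDescentAt f j a δ

/-! ## §3 (S) The realisation socket (law-free nodal-domain bookkeeping) -/

/-- A PETAL MODEL at radius `Im a + δ`: a piece framework `F` (image Y) with a distinguished cycle `pet` whose piece `0` is a pole and a blocking `β`
of it such that level `0` is generic, every block of `β` starts and finishes with the values of an analytic block (`BlockEnds`), the level-`0`
ascent surplus of `F` dominates part Fʼs `#ascStarts − #descStarts`, and twice the pole count is at most the non-real zero count `N_δ`. -/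
def IsPetalModel (f : ℂ → ℂ) (j : ℕ) (a : ℂ) (δ : ℝ) (F : PieceFramework) (pet : Fin F.m) (β : Blocking (F.cyc pet)) : Prop :=
  (F.cyc pet).kind 0 = PieceKind.pole ∧ F.GenericF 0 ∧ (ascStarts f j a δ).Finite ∧
    (((ascStarts f j a δ).ncard : ℤ) - (descStarts f j a δ).ncard ≤ F.asc 0 - F.desc 0) ∧
    2 * F.poles ≤ nonrealZeroMult (iteratedDeriv j f) a.re (a.im + δ) ∧
    ∀ b : Fin β.nb, ∃ t₁ t₂ u₁ u₂ : ℝ, BlockEnds f j a δ t₁ t₂ u₁ u₂ ∧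
      (F.cyc pet).start (β.fst b) = (((arcPhi f j a δ t₁).re : ℝ) : EReal) ∧
      (F.cyc pet).finish (β.lst b) = (((arcPhi f j a δ u₂).re : ℝ) : EReal)

/-- ★ (S) THE PETAL REALISATION SOCKET (OPEN, standard analysis, not in the tree): on a legal frame, a strictly isolated upper zero with no taller
toucher has, on all small circles off a finite set of radii, a degenerate payer or a petal model. -/
def PetalRealisationQ : Prop :=
  ∀ (η : ℝ) (f : ℂ → ℂ) (x₀ s hmax R Hs : ℝ) (B : ℕ), EngineHyps5 2 η f x₀ s hmax R Hs B → ∀ (j : ℕ) (a : ℂ),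
    iteratedDeriv j f a = 0 → 0 < a.im → NoTallerToucher f j a → StrictlyIsolated f j a →
    ∃ d0 > 0, ∃ E : Set ℝ, E.Finite ∧ ∀ δ ∈ Ioo 0 d0 \ E,
      (∃ z : ℂ, DegeneratePayer f j a z) ∨
        ∃ (F : PieceFramework) (pet : Fin F.m) (β : Blocking (F.cyc pet)), IsPetalModel f j a δ F pet β

/-! ## §4 (K) The chain, PROVED -/

/-- The lawʼs conclusion for a zero `a` of `f^{(j)}`. -/
def Pays (f : ℂ → ℂ) (j : ℕ) (a : ℂ) : Prop :=
  (∃ w : ℂ, iteratedDeriv (j + 1) f w = 0 ∧ w.im ≠ 0 ∧ NestedStep a w) ∨ (∃ x : ℝ, |x - a.re| ≤ a.im ∧ NLEventOf f j x)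

/-- `TopPinning` restricted to strictly isolated tops. -/
def IsolatedTopPinningQ : Prop :=
  ∀ (η : ℝ) (f : ℂ → ℂ) (x₀ s hmax R Hs : ℝ) (B : ℕ), EngineHyps5 2 η f x₀ s hmax R Hs B → ∀ (j : ℕ) (a : ℂ),
    iteratedDeriv j f a = 0 → 0 < a.im → NoTallerToucher f j a → StrictlyIsolated f j a → Pays f j a

/-- The residual: `TopPinning` on the NOT strictly isolated tops (another upper zero in the closed Jensen disc — the clustered class). OPEN. -/
def NonIsolatedTopResidualQ : Prop :=
  ∀ (η : ℝ) (f : ℂ → ℂ) (x₀ s hmax R Hs : ℝ) (B : ℕ), EngineHyps5 2 η f x₀ s hmax R Hs B → ∀ (j : ℕ) (a : ℂ),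
    iteratedDeriv j f a = 0 → 0 < a.im → NoTallerToucher f j a → ¬ StrictlyIsolated f j a → Pays f j a

/-- (K) TRANSFER: analytic side-block descent makes a petal modelʼs blocking block-descending. -/
theorem blockDescent_of_sideBlock {f : ℂ → ℂ} {j : ℕ} {a : ℂ} {δ : ℝ} {F : PieceFramework} {pet : Fin F.m} {β : Blocking (F.cyc pet)}
    (hblk : ∀ b : Fin β.nb, ∃ t₁ t₂ u₁ u₂ : ℝ, BlockEnds f j a δ t₁ t₂ u₁ u₂ ∧
      (F.cyc pet).start (β.fst b) = (((arcPhi f j a δ t₁).re : ℝ) : EReal) ∧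
      (F.cyc pet).finish (β.lst b) = (((arcPhi f j a δ u₂).re : ℝ) : EReal))
    (hT : SideBlockDescentAt f j a δ) : BlockDescent (F.cyc pet) β := by
  intro b
  obtain ⟨t₁, t₂, u₁, u₂, hbe, hs, hf⟩ := hblk b
  rw [hs, hf]
  exact EReal.coe_lt_coe_iff.2 (hT t₁ t₂ u₁ u₂ hbe)

/-- (K) A block-descending petal model yields part Fʼs count inequality (image Y: block descent ⇒ a run through `0` ⇒ covered ⇒
`ASC ≤ POLES − 1 + DESC`). -/
theorem arcCountIneq_of_model {f : ℂ → ℂ} {j : ℕ} {a : ℂ} {δ : ℝ} {F : PieceFramework} {pet : Fin F.m} {β : Blocking (F.cyc pet)}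
    (hM : IsPetalModel f j a δ F pet β) (hB : BlockDescent (F.cyc pet) β) : ArcCountIneq f j a δ := by
  obtain ⟨h0, hg, hfin, hcnt, hpol, -⟩ := hM
  refine ⟨hfin, ?_⟩
  obtain ⟨i, hk, hs, hf, -⟩ := exists_run_of_blockDescent (F.cyc pet) (F.chained pet) (F.wellFormed pet) h0 β hB (hg pet)
  have hcov : F.Covered 0 := ⟨pet, i, hk, hs, hf⟩
  have hle := (F.covered_iff_count hg).1 hcov
  linarith

/-- (K) A degenerate payer pays the law outright: off the axis it is a non-real critical point in the closed Jensen disc; on the axis it is an NL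
event (`G·G″ = 0 ≥ 0`). -/
theorem pays_of_degenerate {η : ℝ} {f : ℂ → ℂ} {x₀ s hmax R Hs : ℝ} {B : ℕ} (hE : EngineHyps5 2 η f x₀ s hmax R Hs B) {j : ℕ} {a : ℂ}
    (hapos : 0 < a.im) {z : ℂ} (hz : DegeneratePayer f j a z) : Pays f j a := by
  obtain ⟨hdisc, hzim, hG0, hG1, hG2⟩ := hz
  rcases hzim.lt_or_eq with hpos | hzero
  · exact Or.inl ⟨z, hG1, hpos.ne', hdisc⟩
  · have hzx : z = ((z.re : ℝ) : ℂ) := Complex.ext (by simp) (by simp [← hzero])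
    have hf : RealEntireLt2 f := realEntireLt2_of_hyps hE
    have hGreal : (iteratedDeriv j f (z.re : ℂ)).im = 0 := im_iteratedDeriv_ofReal hf.diff hf.real j z.re
    refine Or.inr ⟨z.re, ?_, ?_, ?_, ?_⟩
    · have hsq : (z.re - a.re) ^ 2 ≤ a.im ^ 2 := by nlinarith [sq_nonneg z.im]
      exact abs_le.2 (abs_le_of_sq_le_sq' hsq hapos.le)
    · rw [← hzx, hG1]; simp
    · intro hre
      apply hG0
      rw [hzx]
      exact Complex.ext (by simpa using hre) (by simpa using hGreal)
    · rw [← hzx, hG2]; simp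

/-- ★★ (K) THE CHAIN: side-block descent and the realisation socket give the law on strictly isolated tops (via image Y and part Hʼs
`pinning_of_arcCount_cofinite`). -/
theorem isolatedTopPinning_of_laws (hT : SideBlockDescentQ) (hS : PetalRealisationQ) : IsolatedTopPinningQ := by
  intro η f x₀ s hmax R Hs B hE j a ha hapos hN hI
  obtain ⟨d₁, hd₁, E₁, hE₁, h₁⟩ := hT η f x₀ s hmax R Hs B hE j a ha hapos hN hI
  obtain ⟨d₂, hd₂, E₂, hE₂, h₂⟩ := hS η f x₀ s hmax R Hs B hE j a ha hapos hN hI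
  by_cases hdeg : ∃ z : ℂ, DegeneratePayer f j a z
  · obtain ⟨z, hz⟩ := hdeg
    exact pays_of_degenerate hE hapos hz
  · refine pinning_of_arcCount_cofinite hE ha hapos ⟨min d₁ d₂, lt_min hd₁ hd₂, E₁ ∪ E₂, hE₁.union hE₂, fun δ hδ => ?_⟩
    have hδ₁ : δ ∈ Ioo 0 d₁ \ E₁ := ⟨⟨hδ.1.1, lt_of_lt_of_le hδ.1.2 (min_le_left _ _)⟩, fun h => hδ.2 (Or.inl h)⟩
    have hδ₂ : δ ∈ Ioo 0 d₂ \ E₂ := ⟨⟨hδ.1.1, lt_of_lt_of_le hδ.1.2 (min_le_right _ _)⟩, fun h => hδ.2 (Or.inr h)⟩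
    rcases h₂ δ hδ₂ with hz | ⟨F, pet, β, hM⟩
    · exact absurd hz hdeg
    · exact arcCountIneq_of_model hM (blockDescent_of_sideBlock hM.2.2.2.2.2 (h₁ δ hδ₁))

/-- (K) EXACT SPLIT of the law at strict isolation. -/
theorem topPinning_of_isolatedSplit (h₁ : IsolatedTopPinningQ) (h₂ : NonIsolatedTopResidualQ) : TopPinning := by
  intro η f x₀ s hmax R Hs B hE j a ha hapos hN
  by_cases hI : StrictlyIsolated f j a
  · exact h₁ η f x₀ s hmax R Hs B hE j a ha hapos hN hI
  · exact h₂ η f x₀ s hmax R Hs B hE j a ha hapos hN hI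

/-- ★★ The law from (T), (S) and the clustered residual. -/
theorem topPinning_of_sideBlock (hT : SideBlockDescentQ) (hS : PetalRealisationQ) (hR : NonIsolatedTopResidualQ) : TopPinning :=
  topPinning_of_isolatedSplit (isolatedTopPinning_of_laws hT hS) hR

/-- Converse bookkeeping: the isolated half is implied by the law. -/
theorem isolatedTopPinning_of_topPinning (hP : TopPinning) : IsolatedTopPinningQ :=
  fun η f x₀ s hmax R Hs B hE j a ha hapos hN _ => hP η f x₀ s hmax R Hs B hE j a ha hapos hN

/-- Converse bookkeeping: the residual is implied by the law (the split is exact). -/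
theorem nonIsolatedResidual_of_topPinning (hP : TopPinning) : NonIsolatedTopResidualQ :=
  fun η f x₀ s hmax R Hs B hE j a ha hapos hN _ => hP η f x₀ s hmax R Hs B hE j a ha hapos hN

/-- The split is exact. -/
theorem topPinning_iff_isolatedSplit : TopPinning ↔ IsolatedTopPinningQ ∧ NonIsolatedTopResidualQ :=
  ⟨fun h => ⟨isolatedTopPinning_of_topPinning h, nonIsolatedResidual_of_topPinning h⟩, fun h => topPinning_of_isolatedSplit h.1 h.2⟩

end RhW08.Lens1SideBlock

end
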